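import Summits.Ventures.Crystal3D.Theorems.StickyWulffConstantPolycrystalWulffBoundQuantile

/-!
# LOWER quantile functions of a compact set along a direction, and «CDF shift ⇒ quantile shift»
# (choice-free data for the charged-wall rung `rung_inclinedLamellar_of_quantiles`, crux `stmt-Ventures-19482`)

Route `StickyWulffConstant` of the venture `Summits/Ventures/Crystal3D`, second prover lane (poly-p2,
gen 8).  For a compact `B ⊆ B̄(0,R)` of volume `M` and a unit vector `n`, the cumulative section volume
`Φ(t) = |B ∩ {⟪y,n⟫ < t}|` is continuous (affine hyperplanes are null, `volume_setOf_inner_eq_zero`),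
vanishes below `−R−1` and equals `M` above `R+1` (as in `…Quantile`); here the LOWER quantile
`q σ = inf {t | Φ t ≥ σ M}` is used, which adds a MINIMALITY clause (`exists_lowerQuantile_of_isCompact`),
and `lowerQuantile_le_add_of_cdf_le` turns the choice-free hypothesis
«`|B' ∩ {⟪y,n⟫ < t}| ≤ |B ∩ {⟪y,n⟫ < t + δ}|` for all `t`» into the quantile mismatch `q σ ≤ q' σ + δ` that
`PolyDensity.rung_inclinedLamellar_of_quantiles` (`…RungInclined`) consumes.
WHAT THIS IS NOT: the value of `δ` for `W` vs `R_m W` (a 1-D computation); the crux is not claimed. -/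

noncomputable section

open scoped BigOperators InnerProductSpace ENNReal Topology
open MeasureTheory Filter Set

namespace Summit.Ventures.Crystal3D.Theorems

open Summit.Ventures.Crystal3D.Cruxes.TextureLiminf.TexShadow (E3)

/-- **LOWER quantile function of a compact set along a unit direction**: as `exists_quantile_of_isCompact`,
with the extra MINIMALITY clause `|B ∩ {⟪y,n⟫ < t}| ≥ σ·M ⇒ q σ ≤ t` (for `t ≥ −R−1`), which turns a shift
of cumulative section volumes into a shift of quantiles (`lowerQuantile_le_add_of_cdf_le`). -/
theorem exists_lowerQuantile_of_isCompact (n : E3) (hn : ‖n‖ = 1) (B : Set E3) (hB : IsCompact B)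
    {R : ℝ} (hR : 0 ≤ R) (hBR : B ⊆ Metric.closedBall 0 R) {M : ℝ} (hM0 : 0 ≤ M)
    (hBM : volume B = ENNReal.ofReal M) :
    ∃ q : ℝ → ℝ, (∀ σ, |q σ| ≤ R + 1) ∧
      (∀ σ₁ σ₂, 0 ≤ σ₁ → σ₁ ≤ σ₂ → σ₂ ≤ 1 →
        ENNReal.ofReal ((σ₂ - σ₁) * M) ≤
          volume (B ∩ {y : E3 | q σ₁ < ⟪y, n⟫_ℝ ∧ ⟪y, n⟫_ℝ < q σ₂})) ∧
      (∀ σ, 0 ≤ σ → σ ≤ 1 →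
        (volume (B ∩ {y : E3 | ⟪y, n⟫_ℝ < q σ})).toReal = σ * M) ∧
      (∀ σ t, 0 ≤ σ → σ ≤ 1 → -(R + 1) ≤ t →
        ENNReal.ofReal (σ * M) ≤ volume (B ∩ {y : E3 | ⟪y, n⟫_ℝ < t}) → q σ ≤ t) := by
  have hn0 : n ≠ 0 := by
    intro h; rw [h, norm_zero] at hn; exact zero_ne_one hn
  have hBm : MeasurableSet B := hB.isClosed.measurableSet
  have hBfin : volume B ≠ ⊤ := hB.measure_lt_top.ne
  have hcont_inner : Continuous fun y : E3 => ⟪y, n⟫_ℝ := continuous_id.inner continuous_const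
  have hlt_m : ∀ t, MeasurableSet {y : E3 | ⟪y, n⟫_ℝ < t} := fun t =>
    (isOpen_lt hcont_inner continuous_const).measurableSet
  -- the cumulative section volume
  set Φ : ℝ → ℝ := fun t => (volume (B ∩ {y : E3 | ⟪y, n⟫_ℝ < t})).toReal with hΦ
  have hfin : ∀ t, volume (B ∩ {y : E3 | ⟪y, n⟫_ℝ < t}) ≠ ⊤ := fun t =>
    ne_top_of_le_ne_top hBfin (measure_mono inter_subset_left)
  have hmono : Monotone Φ := by
    intro s t hst
    exact ENNReal.toReal_mono (hfin t) (measure_mono fun y hy => ⟨hy.1, lt_of_lt_of_le hy.2 hst⟩)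
  have hinnerB : ∀ y ∈ B, |⟪y, n⟫_ℝ| ≤ R := by
    intro y hy
    calc |⟪y, n⟫_ℝ| ≤ ‖y‖ * ‖n‖ := abs_real_inner_le_norm y n
      _ ≤ R * 1 := by rw [hn]; exact mul_le_mul_of_nonneg_right (mem_closedBall_zero_iff.1 (hBR hy)) zero_le_one
      _ = R := mul_one R
  have hΦlow : Φ (-(R + 1)) = 0 := by
    have : B ∩ {y : E3 | ⟪y, n⟫_ℝ < -(R + 1)} = ∅ := by
      ext y
      simp only [mem_inter_iff, mem_setOf_eq, mem_empty_iff_false, iff_false, not_and, not_lt]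
      intro hy
      have := (abs_le.1 (hinnerB y hy)).1
      linarith
    rw [hΦ]; simp only []
    rw [this, measure_empty, ENNReal.toReal_zero]
  have hΦhigh : Φ (R + 1) = M := by
    have : B ∩ {y : E3 | ⟪y, n⟫_ℝ < R + 1} = B := by
      ext y
      simp only [mem_inter_iff, mem_setOf_eq, and_iff_left_iff_imp]
      intro hy
      have := (abs_le.1 (hinnerB y hy)).2
      linarith
    rw [hΦ]; simp only []
    rw [this, hBM, ENNReal.toReal_ofReal hM0]
  -- continuity of `Φ` (hyperplanes are null)
  have hplane : ∀ t, volume (B ∩ {y : E3 | ⟪y, n⟫_ℝ = t}) = 0 := by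
    intro t
    refine measure_mono_null inter_subset_right ?_
    have h := volume_setOf_inner_eq_zero hn0 t
    have hset : {y : E3 | ⟪y, n⟫_ℝ = t} = {y : E3 | ⟪n, y⟫_ℝ = t} := by
      ext y; rw [mem_setOf_eq, mem_setOf_eq, real_inner_comm]
    rw [hset]; exact h
  have hcontΦ : Continuous Φ := by
    rw [Metric.continuous_iff]
    intro t ε hε
    -- from below: `B ∩ {< t} = ⋃_k B ∩ {< t - 1/(k+1)}`
    set Sk : ℕ → Set E3 := fun k => B ∩ {y : E3 | ⟪y, n⟫_ℝ < t - 1 / ((k : ℝ) + 1)} with hSk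
    have hSk_mono : Monotone Sk := by
      intro i j hij y hy
      refine ⟨hy.1, ?_⟩
      show ⟪y, n⟫_ℝ < t - 1 / ((j : ℝ) + 1)
      have hy2 : ⟪y, n⟫_ℝ < t - 1 / ((i : ℝ) + 1) := hy.2
      refine lt_of_lt_of_le hy2 ?_
      have : (1 : ℝ) / ((j : ℝ) + 1) ≤ 1 / ((i : ℝ) + 1) :=
        one_div_le_one_div_of_le (by positivity) (by exact_mod_cast Nat.succ_le_succ hij)
      linarith
    have hSk_union : (⋃ k, Sk k) = B ∩ {y : E3 | ⟪y, n⟫_ℝ < t} := by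
      ext y
      simp only [mem_iUnion, hSk, mem_inter_iff, mem_setOf_eq]
      constructor
      · rintro ⟨k, hyB, hyk⟩
        exact ⟨hyB, lt_of_lt_of_le hyk (by
          have : (0 : ℝ) < 1 / ((k : ℝ) + 1) := by positivity
          linarith)⟩
      · rintro ⟨hyB, hyt⟩
        obtain ⟨k, hk⟩ := exists_nat_one_div_lt (sub_pos.2 hyt)
        exact ⟨k, hyB, by linarith⟩
    have hlow_lim : Tendsto (fun k => (volume (Sk k)).toReal) atTop (𝓝 (Φ t)) := by
      have h := tendsto_measure_iUnion_atTop (μ := volume) hSk_mono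
      rw [hSk_union] at h
      exact (ENNReal.tendsto_toReal (hfin t)).comp h
    -- from above: `B ∩ {≤ t} = ⋂_k B ∩ {< t + 1/(k+1)}`, and the plane `{= t}` is null
    set Tk : ℕ → Set E3 := fun k => B ∩ {y : E3 | ⟪y, n⟫_ℝ < t + 1 / ((k : ℝ) + 1)} with hTk
    have hTk_anti : Antitone Tk := by
      intro i j hij y hy
      refine ⟨hy.1, ?_⟩
      show ⟪y, n⟫_ℝ < t + 1 / ((i : ℝ) + 1)
      have hy2 : ⟪y, n⟫_ℝ < t + 1 / ((j : ℝ) + 1) := hy.2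
      refine lt_of_lt_of_le hy2 ?_
      have : (1 : ℝ) / ((j : ℝ) + 1) ≤ 1 / ((i : ℝ) + 1) :=
        one_div_le_one_div_of_le (by positivity) (by exact_mod_cast Nat.succ_le_succ hij)
      linarith
    have hTk_inter : (⋂ k, Tk k) = B ∩ {y : E3 | ⟪y, n⟫_ℝ ≤ t} := by
      ext y
      simp only [mem_iInter, hTk, mem_inter_iff, mem_setOf_eq]
      constructor
      · intro h
        refine ⟨(h 0).1, le_of_forall_pos_lt_add fun δ hδ => ?_⟩
        obtain ⟨k, hk⟩ := exists_nat_one_div_lt hδ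
        have := (h k).2
        linarith
      · rintro ⟨hyB, hyt⟩ k
        exact ⟨hyB, lt_of_le_of_lt hyt (by
          have : (0 : ℝ) < 1 / ((k : ℝ) + 1) := by positivity
          linarith)⟩
    have hle_eq : volume (B ∩ {y : E3 | ⟪y, n⟫_ℝ ≤ t}) = volume (B ∩ {y : E3 | ⟪y, n⟫_ℝ < t}) := by
      have hsplit : B ∩ {y : E3 | ⟪y, n⟫_ℝ ≤ t} =
          (B ∩ {y : E3 | ⟪y, n⟫_ℝ < t}) ∪ (B ∩ {y : E3 | ⟪y, n⟫_ℝ = t}) := by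
        ext y
        simp only [mem_inter_iff, mem_setOf_eq, mem_union]
        constructor
        · rintro ⟨hyB, hyt⟩
          rcases hyt.lt_or_eq with h | h
          · exact Or.inl ⟨hyB, h⟩
          · exact Or.inr ⟨hyB, h⟩
        · rintro (⟨hyB, h⟩ | ⟨hyB, h⟩)
          · exact ⟨hyB, h.le⟩
          · exact ⟨hyB, h.le⟩
      rw [hsplit]
      apply le_antisymm
      · calc volume (B ∩ {y : E3 | ⟪y, n⟫_ℝ < t} ∪ B ∩ {y : E3 | ⟪y, n⟫_ℝ = t})
            ≤ volume (B ∩ {y : E3 | ⟪y, n⟫_ℝ < t}) + volume (B ∩ {y : E3 | ⟪y, n⟫_ℝ = t}) :=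
              measure_union_le _ _
          _ = volume (B ∩ {y : E3 | ⟪y, n⟫_ℝ < t}) := by rw [hplane t, add_zero]
      · exact measure_mono subset_union_left
    have hhigh_lim : Tendsto (fun k => (volume (Tk k)).toReal) atTop (𝓝 (Φ t)) := by
      have h := tendsto_measure_iInter_atTop (μ := volume)
        (fun k => ((hBm.inter (hlt_m _)).nullMeasurableSet)) hTk_anti ⟨0, hfin _⟩
      rw [hTk_inter, hle_eq] at h
      exact (ENNReal.tendsto_toReal (hfin t)).comp h
    -- extract an index
    obtain ⟨k₁, hk₁⟩ := (Metric.tendsto_atTop.1 hlow_lim) (ε / 2) (half_pos hε)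
    obtain ⟨k₂, hk₂⟩ := (Metric.tendsto_atTop.1 hhigh_lim) (ε / 2) (half_pos hε)
    set kk : ℕ := max k₁ k₂ with hkk
    refine ⟨1 / ((kk : ℝ) + 1), by positivity, fun s hs => ?_⟩
    have h1 := hk₁ kk (le_max_left _ _)
    have h2 := hk₂ kk (le_max_right _ _)
    rw [Real.dist_eq] at h1 h2 hs ⊢
    have hs' := abs_lt.1 hs
    -- `Φ(t − 1/(kk+1)) ≤ Φ s ≤ Φ(t + 1/(kk+1))`
    have hlo : (volume (Sk kk)).toReal ≤ Φ s := hmono (by linarith [hs'.1])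
    have hhi : Φ s ≤ (volume (Tk kk)).toReal := hmono (by linarith [hs'.2])
    have h1' := abs_lt.1 h1
    have h2' := abs_lt.1 h2
    rw [abs_lt]
    constructor <;> linarith
  -- the LOWER quantile: `q σ = inf {t ∈ [−R−1, R+1] | Φ t ≥ σ M}`
  set T : ℝ → Set ℝ := fun σ => {t : ℝ | -(R + 1) ≤ t ∧ t ≤ R + 1 ∧ σ * M ≤ Φ t} with hT
  have hTne : ∀ σ, σ ≤ 1 → (T σ).Nonempty := fun σ h1 =>
    ⟨R + 1, by linarith, le_rfl, by rw [hΦhigh]; nlinarith⟩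
  have hTbdd : ∀ σ, BddBelow (T σ) := fun σ => ⟨-(R + 1), fun t ht => ht.1⟩
  set q : ℝ → ℝ := fun σ => if σ ≤ 1 then sInf (T σ) else 0 with hq
  have hq_eq : ∀ σ, σ ≤ 1 → q σ = sInf (T σ) := fun σ h => by rw [hq]; simp only [if_pos h]
  have hq_mem : ∀ σ, σ ≤ 1 → q σ ∈ T σ := by
    intro σ h1
    rw [hq_eq σ h1]
    -- `T σ` is closed (continuity of `Φ`), bounded below and nonempty
    have hclosed : IsClosed (T σ) := by
      have : T σ = Icc (-(R + 1)) (R + 1) ∩ Φ ⁻¹' Ici (σ * M) := by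
        ext t; simp only [hT, mem_setOf_eq, mem_inter_iff, mem_Icc, mem_preimage, mem_Ici]; tauto
      rw [this]
      exact isClosed_Icc.inter (isClosed_Ici.preimage hcontΦ)
    exact hclosed.csInf_mem (hTne σ h1) (hTbdd σ)
  have hq_bounds : ∀ σ, σ ≤ 1 → -(R + 1) ≤ q σ ∧ q σ ≤ R + 1 := fun σ h1 =>
    ⟨(hq_mem σ h1).1, (hq_mem σ h1).2.1⟩
  have hq_min : ∀ σ t, σ ≤ 1 → -(R + 1) ≤ t → σ * M ≤ Φ t → q σ ≤ t := by
    intro σ t h1 ht hΦt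
    rw [hq_eq σ h1]
    by_cases htR : t ≤ R + 1
    · exact csInf_le (hTbdd σ) ⟨ht, htR, hΦt⟩
    · exact le_trans (csInf_le (hTbdd σ) ⟨by linarith, le_rfl, by rw [hΦhigh]; nlinarith⟩) (by linarith)
  -- `Φ (q σ) = σ M`
  have hq_val : ∀ σ, 0 ≤ σ → σ ≤ 1 → Φ (q σ) = σ * M := by
    intro σ h0 h1
    refine le_antisymm ?_ (hq_mem σ h1).2.2
    by_contra hlt
    rw [not_le] at hlt
    -- continuity from the left: some `t < q σ` already has `Φ t ≥ σ M`
    rcases eq_or_lt_of_le (hq_bounds σ h1).1 with heq | hgt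
    · rw [← heq, hΦlow] at hlt
      have : 0 ≤ σ * M := by positivity
      linarith
    · have hc := (hcontΦ.tendsto (q σ))
      have hev : ∀ᶠ t in 𝓝 (q σ), σ * M < Φ t := hc.eventually (lt_mem_nhds hlt)
      have hev' : ∀ᶠ t in 𝓝[<] (q σ), σ * M < Φ t ∧ -(R + 1) < t ∧ t < q σ := by
        have h1 : ∀ᶠ t in 𝓝[<] (q σ), σ * M < Φ t := nhdsWithin_le_nhds hev
        have h2 : ∀ᶠ t in 𝓝[<] (q σ), -(R + 1) < t ∧ t < q σ := by
          filter_upwards [Ioo_mem_nhdsLT hgt] with t ht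
          exact ⟨ht.1, ht.2⟩
        exact h1.and h2
      obtain ⟨t, ht1, ht2, ht3⟩ := hev'.exists
      have := hq_min σ t h1 ht2.le ht1.le
      linarith
  refine ⟨q, fun σ => ?_, fun σ₁ σ₂ h0 h12 h1 => ?_, fun σ h0 h1 => ?_, fun σ t h0 h1 ht hvol => ?_⟩
  · by_cases h1 : σ ≤ 1
    · exact abs_le.2 (hq_bounds σ h1)
    · rw [hq]; simp only [if_neg h1, abs_zero]; positivity
  · have hΦ1 : Φ (q σ₁) = σ₁ * M := hq_val σ₁ h0 (h12.trans h1)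
    have hΦ2 : Φ (q σ₂) = σ₂ * M := hq_val σ₂ (h0.trans h12) h1
    -- `|B ∩ {q₁ < · < q₂}| ≥ Φ(q₂) − Φ(q₁) − |plane at q₁|`
    have hsub : B ∩ {y : E3 | ⟪y, n⟫_ℝ < q σ₂} ⊆
        (B ∩ {y : E3 | q σ₁ < ⟪y, n⟫_ℝ ∧ ⟪y, n⟫_ℝ < q σ₂}) ∪ (B ∩ {y : E3 | ⟪y, n⟫_ℝ ≤ q σ₁}) := by
      rintro y ⟨hyB, hy2⟩
      by_cases hy1 : q σ₁ < ⟪y, n⟫_ℝ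
      · exact Or.inl ⟨hyB, hy1, hy2⟩
      · exact Or.inr ⟨hyB, not_lt.1 hy1⟩
    have hle_eq1 : volume (B ∩ {y : E3 | ⟪y, n⟫_ℝ ≤ q σ₁}) ≤
        volume (B ∩ {y : E3 | ⟪y, n⟫_ℝ < q σ₁}) + volume (B ∩ {y : E3 | ⟪y, n⟫_ℝ = q σ₁}) := by
      refine (measure_mono ?_).trans (measure_union_le _ _)
      rintro y ⟨hyB, hyt⟩
      have hyt' : ⟪y, n⟫_ℝ ≤ q σ₁ := hyt
      rcases hyt'.lt_or_eq with h | h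
      · exact Or.inl ⟨hyB, h⟩
      · exact Or.inr ⟨hyB, h⟩
    rw [hplane, add_zero] at hle_eq1
    have hmain : volume (B ∩ {y : E3 | ⟪y, n⟫_ℝ < q σ₂}) ≤
        volume (B ∩ {y : E3 | q σ₁ < ⟪y, n⟫_ℝ ∧ ⟪y, n⟫_ℝ < q σ₂}) +
          volume (B ∩ {y : E3 | ⟪y, n⟫_ℝ < q σ₁}) :=
      (measure_mono hsub).trans ((measure_union_le _ _).trans (by gcongr))
    have hfinW : volume (B ∩ {y : E3 | q σ₁ < ⟪y, n⟫_ℝ ∧ ⟪y, n⟫_ℝ < q σ₂}) ≠ ⊤ :=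
      ne_top_of_le_ne_top hBfin (measure_mono inter_subset_left)
    have hreal := ENNReal.toReal_mono (ENNReal.add_ne_top.2 ⟨hfinW, hfin _⟩) hmain
    rw [ENNReal.toReal_add hfinW (hfin _)] at hreal
    have e2 : (volume (B ∩ {y : E3 | ⟪y, n⟫_ℝ < q σ₂})).toReal = σ₂ * M := hΦ2
    have e1 : (volume (B ∩ {y : E3 | ⟪y, n⟫_ℝ < q σ₁})).toReal = σ₁ * M := hΦ1
    rw [e2, e1] at hreal
    rw [← ENNReal.ofReal_toReal hfinW]
    exact ENNReal.ofReal_le_ofReal (by linarith)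
  · exact hq_val σ h0 h1
  · refine hq_min σ t h1 ht ?_
    have h := ENNReal.toReal_mono (hfin t) hvol
    rwa [ENNReal.toReal_ofReal (by positivity)] at h

/-- **A shift of cumulative section volumes is a shift of lower quantiles.**  If the bodies `B`, `B'`
(same volume `M`) satisfy `|B' ∩ {⟪y,n⟫ < t}| ≤ |B ∩ {⟪y,n⟫ < t + δ}|` for all `t` (`δ ≥ 0`), then the lower
quantile functions satisfy `q σ ≤ q' σ + δ` on `[0,1]`. -/
theorem lowerQuantile_le_add_of_cdf_le (n : E3) (B B' : Set E3) {R M δ : ℝ} (hδ : 0 ≤ δ)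
    (q q' : ℝ → ℝ)
    (hq'val : ∀ σ, 0 ≤ σ → σ ≤ 1 → (volume (B' ∩ {y : E3 | ⟪y, n⟫_ℝ < q' σ})).toReal = σ * M)
    (hq'bd : ∀ σ, |q' σ| ≤ R + 1)
    (hfin : ∀ t, volume (B' ∩ {y : E3 | ⟪y, n⟫_ℝ < t}) ≠ ⊤)
    (hqmin : ∀ σ t, 0 ≤ σ → σ ≤ 1 → -(R + 1) ≤ t →
      ENNReal.ofReal (σ * M) ≤ volume (B ∩ {y : E3 | ⟪y, n⟫_ℝ < t}) → q σ ≤ t)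
    (hshift : ∀ t, volume (B' ∩ {y : E3 | ⟪y, n⟫_ℝ < t}) ≤ volume (B ∩ {y : E3 | ⟪y, n⟫_ℝ < t + δ})) :
    ∀ σ, 0 ≤ σ → σ ≤ 1 → q σ ≤ q' σ + δ := by
  intro σ h0 h1
  refine hqmin σ (q' σ + δ) h0 h1 (by linarith [(abs_le.1 (hq'bd σ)).1]) ?_
  calc ENNReal.ofReal (σ * M) = ENNReal.ofReal ((volume (B' ∩ {y : E3 | ⟪y, n⟫_ℝ < q' σ})).toReal) := by
        rw [hq'val σ h0 h1]
    _ = volume (B' ∩ {y : E3 | ⟪y, n⟫_ℝ < q' σ}) := ENNReal.ofReal_toReal (hfin _)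
    _ ≤ volume (B ∩ {y : E3 | ⟪y, n⟫_ℝ < q' σ + δ}) := hshift _

end Summit.Ventures.Crystal3D.Theorems

end
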